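import Mathlib
import HarnessLib
import HarnessLib.Audit
import Summits.HubbardSuperconductivity.Statement

/-!
Route: MottCornerCeiling

CLOSED (retired) 2026-08-15T13:48:20Z by operator:999:1257524 — reason: not-a-thesis: assembly does not conclude the sub-problem Statement — note: D-0027 §2.1 audit (human 2026-08-15: routes that do not decide the summit are removed): the assembly concludes `MottCornerLaw`, not the sub-problem statement; a NEW conforming route may be opened from the same idea (generated `closes : … → _root_.HubbardSuperconductivity`).. The file is kept as the record of this route; refuted decls are indexed as negative knowledge (`ledger negatives`).

Route MottCornerCeiling — HubbardSuperconductivity/HubbardSuperconductivity (plancard 2026-08-15;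
realises idea card mott-corner-order-ceiling, novelty audit: new-combination, "route it as a small
provable support route"; absorbs the retired sibling card hole-pair-room-mottness-ceiling, whose
hypothesis-free every-state counting inequality is crux HolePairRoom).

KIND: CEILING / CALIBRATION ROUTE. It proves neither S nor ¬S and does not pretend to: its Assembly
decl concludes the ROUTE TARGET MottCornerLaw, not the constant `HubbardSuperconductivity`. Reason:
a ceiling that is O(δ) > 0 at every fixed (U, δ) cannot be load-bearing for S or for ¬S, and
dressing it as either would be a costume. Its deliverables are theorems in Theorems/ that (i) bound
the summit's own functional for EVERY ground state, uniformly in L, (ii) quantify where a witness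
(U, δ, c) of S can live (c ≤ A·δ + B/√U; in the wedge c ≤ A·ρ_hh + B/U²), (iii) give refuters and
the certificate routes (GSCertificate, NoGo's regional census, PlaquetteBoson's continuation leg) a
number: the largest d-wave order the doped Mott regime can carry is the real-space HOLE-PAIR
density.

THESIS X (it suffices to show) = MottCornerLaw: there are absolute constants A, B such that for
every U ≥ 1 (t = 1), every side L ≥ 1, every electron number N ≤ L² and EVERY normalised (N, S^z =
0)-sector ground state ψ of `hubbardTorus 2 L 1 U`,
    re ⟨ψ, Δ_d† Δ_d ψ⟩ ≤ (A·δ_L + B/√U)·L⁴ + A·L³,   δ_L := 1 − N/L² (the actual hole doping),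
with Δ_d = pairField dWaveFormFactor L (= √2 × Scalapino's Δ_d, immaterial). In words: the summit's
order functional L⁻⁴⟨Δ_d†Δ_d⟩ is at most LINEAR IN THE DOPING plus √(t/U), for every ground state
and every L — d-wave pair order vanishes continuously into the Mott/atomic corner (δ, t/U) → (0, 0)
("no two adjacent holes, no superconductivity"). One-line Lean form: the decl `MottCornerLaw` below
(rc0 in the planner's Sketch.lean; every constant exists:
Literature.MathematicalPhysics.QuantumLattice.{expect, pairField, dWaveFormFactor,
IsGroundStateInSector, hubbardTorus, numberOp, FermionTorus, FermionTorus.ofTorusSite, unitSteps,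
szSector, Fock, Orb}, Literature.Probability.LatticeModels.{TorusSite, Torus.proj, Site},
Matrix.minEnergyOn).

ASSEMBLY (internal; bookkeeping only): HolePairRoom → GroundStateDoublonBudget → MottCornerLaw,
through HH(ψ) := Σ_x Σ_{e=±e₁,±e₂} ⟨E_x E_{x+e}⟩ ≤ 4⟨#empty sites⟩ = 4(L²δ_L + D(ψ)) (E_x =
(1−n_{x↑})(1−n_{x↓}); Σ_x E_x = L² − N̂ + D̂ on the N-sector) and D(ψ) := Σ_x⟨n_{x↑}n_{x↓}⟩ ≤ 4N/U.

TWO-LAYER PLAN (D-0019). Layer 1 = the ranked statements of this file. Layer 2 (planner-owned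
splits, only after a crux closes or stalls with a census): under MottCornerLawSharp — (a)
DoublonGrading: Δ_g† = G† + X₁† + X₂† (G† creates the singlet on two EMPTY sites, X_j† creates
exactly j doublons), [D, X_j†] = j·X_j†, [N̂, X_j†] = 2X_j†, and the projection-free moment bound
‖(K − E^K − (jU − 2μ))X_j†ψ‖ = ‖[T, X_j†]ψ‖ ≤ c_T·L² (K = H − μN̂, 2μ = E(N+2) − E(N)); (b)
FirstMomentTail: ⟨Δ†ψ,(K−E^K)Δ†ψ⟩ + ⟨Δψ,(K−E^K)Δψ⟩ = ⟨[Δ,[K,Δ†]]⟩ ≤ C_D(U)·L² (KomaTasaki1994 Thm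
2.2 / Horsch–von der Linden read FORWARDS as a weight-localisation tool) ⇒ weight of Δ_d†ψ above
excitation ε is ≤ (C_D L² + κ_L‖Δψ‖²)/ε; (c) AdditionCapacity: ‖G†ψ‖² ≤ c_G·L²·HH(ψ) (G_x† = G_x†Q_x
with Q_x the empty-bond projector; Cauchy–Schwarz). Under HolePairRoom — the 16-channel two-sided
conditioning lemma for disjoint bonds. Glue statements are filed with the split, not now.

RANKED CRUXES: 2 HolePairRoom (the engine; every state, every form factor g: ⟨Δ_g†Δ_g⟩ ≤ C(L²·HH +
L³·√D + L²)) · 3 MottCornerLawSharp (the card's new-combination mechanism: in the wedge U ≥ U₁(δ),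
every GS has ⟨Δ_d†Δ_d⟩ ≤ A·L²·HH + (B/U² + η)L⁴ eventually — doublon channels are O(t²/U²) by exact
grading + spectral Chebyshev with ABSOLUTE spread, no Schrieffer–Wolff) · 4 SectorPairEnergyBounds
(|E(N_L+2) − E(N_L)| ≤ C(δ) and pair-concavity defect κ_L = 2E(N_L) − E(N_L−2) − E(N_L+2) ≤ C(δ),
uniformly in U > 0 and large L — replaces the card's hypothesis H1). Support:
GroundStateDoublonBudget (U·D(ψ) ≤ 4N). Plus Target and Assembly: 6 items.

UNDER FLOOR: fewer than 2 cruxes remain after retriage (legacy route; D-0019).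

Rationale: WHY THIS LINE. Every rigorous handle on pairing in the doped repulsive Hubbard model is either T > 0
(KomaTasakiPRL1992, SuSchadschneiderZittartz1997), attractive-U (Tian1992), quasi-free
(BachLiebSolovej1994) or a global kinematic count blind to Mottness (Yang1962 §4: λ_max(ρ₂) ≤
N(M−N+2)/M). The physics folklore of the doped Mott regime is sharper: the superconducting amplitude
is throttled by the hole density — Gutzwiller factor g_t = 2δ/(1+δ), Φ_SC ∝ δ
(ZhangGrosRiceShiba1988; ParamekantiRanderiaTrivedi2004 §V.A), rigorous only for the STIFFNESS via
the kinetic-energy bound (HazraVermaRanderia2019). For hard-core BOSONS the free-volume ceiling n₀ ≤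
ρ(1−ρ) is a theorem (Toth1991; TennieVedralSchilling2017 Thm 1). This route transplants the
free-volume count to the UNPROJECTED Hubbard pair field (crux HolePairRoom: occupation-basis
conditioning on both bonds, 16 spectator-spin channels, Cauchy–Schwarz) and controls what bosons and
the t-J model do not have — the doublon channels — twice: cheaply by the ground-state doublon budget
U·D ≤ 4tN (support), giving the hypothesis-free corner law LRO_d ≤ Aδ + B√(t/U) (target), and
sharply by the card's mechanism (crux MottCornerLawSharp): exact doublon grading [D, X_j†] = jX_j†
plus Chebyshev on the spectral measure of K = H − μN̂ in the vector X_j†ψ, whose spread is ABSOLUTE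
(‖[T,X_j†]‖ ≤ c_T L²), so the doublon channels carry O(t²/U²) low-energy weight with no t/U
expansion — valid for the true SU(2) ground state, which is exactly what
Literature.Barriers.HubbardSuperconductivity.StrongCouplingCeiling records as out of reach of
expansions (DattaFernandezFrohlich1999 §1.2, §4). The high-energy tail is dismissed by the
Horsch–von der Linden / KomaTasaki1994 Thm 2.2 first-moment identity read forwards. Imported areas:
free-volume/occupation counting (lattice Bose gases, quantum-information N-representability bounds),
spectral moment methods (Chebyshev/Markov on spectral measures), variational sector-energy estimates
(crux SectorPairEnergyBounds, which REPLACES the card's unproved hypothesis H1: κ_L ≤ C(δ) suffices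
once ε := 2κ_L + 1). Catalogue used: quantify-a-qualitative-result (effective Gutzwiller law),
certificate-free every-GS statements; no physical analogy is load-bearing.
RANKED CRUXES. 2 HolePairRoom — engine; refutable by a 4×4 ED sanity check of the SHAPE (not of
constants): if ⟨Δ_d†Δ_d⟩ outgrows C(L²HH + L³√D + L²) for every C ≲ 10³ at U = 8–16, N = 12, 14, a
channel was mis-booked. 3 MottCornerLawSharp — hardest; needs 4 and the spectral bookkeeping; U₁(δ)
~ C/δ (wedge Uδ ≳ C), L → ∞ before U → ∞. 4 SectorPairEnergyBounds — two-sided chemical-potential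
and pair-concavity bounds for sector minima, uniform in U; variational (projected two-electron
insertion/removal), physically generous (O(t/δ) where O(t) is expected).
KILL CRITERIA. (i) HolePairRoom refuted in its LINEAR form ⇒ restate with √(L²·HH) (the (A)-form;
then the law is Aδ^{1/2}, route value drops — consider close exhausted after landing the lemma);
(ii) SectorPairEnergyBounds refuted (κ_L or μ_L unbounded at some δ) ⇒ restate MottCornerLawSharp
along the subsequence of pair-convex L or with ε_L ↑ slowly, else drop it and keep the weak law;
(iii) target proved ⇒ route done: close with the census "corner calibrated", promote
HolePairRoom/MottCornerLaw as Literature facts for NoGo/GSCertificate; (iv) constants: if the proved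
A exceeds ~10³ the law is numerically vacuous below L ~ 30 — say so in the census, do not split
further.
NOT DECOMPOSED YET (deliberately): the pair-REMOVAL twin (X_j ↦ doublon-annihilating parts); η- and
extended-s channels (HolePairRoom already covers every form factor g); the identity Δ_d =
−(1/√2)[T_d, η₀] (Zhang1990 algebra, in pool twice) explaining why doublons must enter; connected
hole-pair correlations in place of ρ_hh; d_ψ = O(t²/U²) for ground states (needs an energy LOWER
bound at strong coupling — barrier territory); any use of the ceiling inside NoGo (it excludes
nothing) or PlaquetteBoson (consistency number only).
NOVELTY / BARRIERS: full text in the route's Novelty and Barriers fields (searched this session: lit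
search --hybrid, lit galaxy --star all, crossref ×3, lit frontier; nearest prior Toth1991 /
TennieVedralSchilling2017 / Yang1962 §4 / ZhangGrosRiceShiba1988 / HazraVermaRanderia2019 /
Tian1992; audited grades new-combination (card) and variant (absorbed sibling)).

Novelty: Nearest prior art: Toth1991 and TennieVedralSchilling2017 (free-volume ceilings on the condensate of
hard-core lattice bosons — the bosonic form of HolePairRoom's (00,00) channel); Yang1962 §4
(λ_max(ρ₂) ≤ N(M−N+2)/M, blind to Mottness); ZhangGrosRiceShiba1988 / ParamekantiRanderiaTrivedi2004
(the O(δ) law as Gutzwiller/RMFT folklore, non-rigorous, projected Hilbert space);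
HazraVermaRanderia2019 (rigorous, but for the superfluid stiffness, via the optical sum rule);
Tian1992 (rigorous ODLRO statements, attractive U only).
DELTA: (1) an every-state operator inequality for the UNPROJECTED Hubbard pair field, ⟨Δ_g†Δ_g⟩ ≤
C(L²·HH + L³·√D + L²), linear in the empty-bond count thanks to two-sided conditioning over the 16
spectator-spin channels (bosons have one channel, the t-J space has no doublon channels); (2) the
every-ground-state corner law LRO_d ≤ Aδ + B√(t/U), all U ≥ t, all L, no hypotheses; (3) in the
wedge U ≥ U₁(δ) the doublon channels controlled NON-PERTURBATIVELY by the exact grading [D, X_j†] =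
jX_j† + Chebyshev with absolute spread ‖[T, X_j†]‖ ≤ c_T L² (instead of Schrieffer–Wolff), with the
Horsch–von der Linden/Koma–Tasaki first moment read forwards for the tail and the card's hypothesis
H1 replaced by a provable pair-concavity bound. Audited grades: new-combination
(mott-corner-order-ceiling), variant (hole-pair-room-mottness-ceiling, absorbed). No printed
statement of (1)–(3) for the Hubbard model was found.
Searched this session: lit search --hybrid "rigorous  [refs: 10.1103/physrevb.45.3145, 10.1016/S0375-9601(97, 10.1016/s0375-9601(97, 10.1063/1.2437650, 10.1007/bf01329865, 10.1088/1367-2630/3/1/323, 2601.18868, doi:10.1103/physrevb.45.3145, doi:10.1016/S0375-9601, doi:10.1016/s0375-9601, doi:10.1063/1.2437650, doi:10.1007/bf01329865, doi:10.1088/1367-2630/3/1/323, Toth1991, TennieVedralSchilling2017, Yang1962, ZhangGrosRiceShiba1988, ParamekantiRanderiaTriv]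

Barriers (technique_class: occupation-counting; spectral-moment-Chebyshev; variational): technique_class: occupation-counting; spectral-moment-Chebyshev; variational
- Literature.Barriers.HubbardSuperconductivity.StrongCouplingCeiling: EVADED — no t/U, cluster,
polymer or Pirogov–Sinai expansion and no effective Hamiltonian; the upper Hubbard band is handled
by the EXACT commutators [D, X_j†] = jX_j†, ‖[T, X_j†]‖ ≤ c_T L² and Chebyshev's inequality on a
spectral measure, valid for the true SU(2)-symmetric sector ground state at every U ≥ U₁(δ); the
weak law needs only the one-line doublon budget U·D ≤ 4tN. Residue: the wedge U₁(δ) ~ C t/δ (the law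
says nothing new for Uδ ≲ C beyond the weak form).
- Literature.Barriers.HubbardSuperconductivity.LROForcesLowLyingStates: USED FORWARDS, not fought —
KomaTasaki1994 Thm 2.2 / Horsch–von der Linden's double-commutator identity is the tail-localisation
step of MottCornerLawSharp; the route bounds fixed-N pair correlations ⟨Δ†Δ⟩ (never an anomalous
average), so clause (a) is respected by construction.
- Literature.Barriers.HubbardSuperconductivity.GeneralizedHartreeFockNoPairing: not in class — no
quasi-free or variational ansatz for the state; the inequalities hold for every state / every sector
ground state.
- Literature.Barriers.HubbardSuperconductivity.WeakCouplingCeiling and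
Literature.Barriers.HubbardSuperconductivity.PerturbativeInvisibilityOfPairing: not in class — no
series in U; at small U the bound is honest but vacuous (√(t/U) ≥ 1), the weak-coupling corner
belongs to the probe-legendre / kinetic-budget cards.

Novelty grade: new-combination — ROUTE REVIEW (refuter one-shot 2026-08-15). MATH VERDICT: all 6 items rc0 (verbatim scratch copy; Theses module unbuilt on farm), well-typed, non-vacuous, and — except MottCornerLawSharp — essentially PROVABLE as sketched; stamped with briefings. I re-derived HolePairRoom's 16-channel Cauchy–Schwarz (refuter refuter-rreview-route-AnomalousDissipati-ed8239d6-0, 2026-08-15T11:22:00Z; prior: doi:10.1007/bf01329865 (Toth1991, free-volume condensate ceiling), TennieVedralSchilling2017 Thm 1, Yang1962 §4 (λ_max(ρ₂) ≤ N(M−N+2)/M), ZhangGrosRiceShiba1988 / ParamekantiRanderiaTrivedi2004 §V.A (Gutzwiller g_t ∝ δ), HazraVermaRanderia2019 (rigorous stiffness bound), KomaTasaki1994 Thm 2.2)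

History (route lifecycle, newest last):
- 2026-08-15T13:48:20Z · CLOSED retired — not-a-thesis: assembly does not conclude the sub-problem Statement (operator:999:1257524)

sub-problem: HubbardSuperconductivity · status: closed(retired) · opened planner-plancard-HubbardSuperconductivity-Hub-9588fec8-0 2026-08-15T10:56:35Z · rev 1 · ledger route-HubbardSuperconductivity-MottCornerCeiling
GENERATED by the gate from the ledger (D-0016/17). Provers cite these decls: `theorem foo : Summit.HubbardSuperconductivity.HubbardSuperconductivity.Theses.MottCornerCeiling.<Decl> := …` in Summits/HubbardSuperconductivity/HubbardSuperconductivity/Theorems/<Name>.lean.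
-/

namespace Summit.HubbardSuperconductivity.HubbardSuperconductivity.Theses.MottCornerCeiling

open scoped BigOperators Topology Manifold Classical MeasureTheory ProbabilityTheory Matrix InnerProductSpace ComplexConjugate ContinuousMap
open Filter Set Function TopologicalSpace MeasureTheory

attribute [summit_statement] _root_.HubbardSuperconductivity

open Literature.Hubbard

/-- item stmt-HubbardSuperconductivity-1465 · target · rank 0 · closed · moot by None · by planner
why it might fail: Bookkeeping from HolePairRoom (d-wave, side L+1) + GroundStateDoublonBudget: HH <= 4((L+1)^2 delta_L + D), UD <= 4N, U >= 1 => A=4C, B=18C. Inherits only HolePairRoom's linear (00,00) term (judged routine); B/√U is intrinsic to the every-state route; C ~ 1e2-1e3: vacuous below L~30, not false.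
sources: ZhangGrosRiceShiba1988, HazraVermaRanderia2019, Scalapino1995, Toth1991
[target] MOTT-CORNER LAW (weak, hypothesis-free form = thesis X): there are A, B with: for all U >=
1, all L, all N <= L^2 and every normalised (N, S^z=0)-sector GS psi, re<Delta_d^+ Delta_d> <= (A (1
- N/L^2) + B/sqrt U) L^4 + A L^3. From HolePairRoom (g = dWaveFormFactor) +
GroundStateDoublonBudget: HH <= Sum_x Sum_e <E_x> = 4<E> (E_x E_{x+e} <= E_x, commuting
projections), <E> = L^2 - N + D (E_x = 1 - n_up - n_dn + n_up n_dn summed over TorusSite ~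
FermionTorus), D <= 4N/U <= 4L^2/U; so <Delta^+ Delta> <= C(4 L^4 delta_L + 16 L^4/U + 2 L^4/sqrt U
+ L^2) <= (4C delta_L + 18C/sqrt U) L^4 + C L^3 for U >= 1: A = 4C, B = 18C. Reading: L^-4
<Delta_d^+ Delta_d> <= A delta + B sqrt(t/U) + A/L for EVERY ground state and every L, so the
summit's witness constant obeys c(U, delta) <= A delta + B/sqrt U, d-wave order vanishes
continuously into the corner (delta, t/U) -> (0, 0), and the Gutzwiller law 'Phi^2 <~ delta' becomes
a theorem for the unprojected model (stiffness analogue: HazraVermaRanderia2019). -/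
@[route_item "route-HubbardSuperconductivity-MottCornerCeiling"]
def MottCornerLaw : Prop :=
  ∃ A B : ℝ, ∀ (U : ℝ), 1 ≤ U → ∀ (L N : ℕ) (ψ : Literature.MathematicalPhysics.QuantumLattice.Fock (Literature.MathematicalPhysics.QuantumLattice.Orb (Literature.MathematicalPhysics.QuantumLattice.FermionTorus 2 (L + 1)))), N ≤ (L + 1) ^ 2 → star ψ ⬝ᵥ ψ = 1 → Literature.MathematicalPhysics.QuantumLattice.IsGroundStateInSector (Literature.MathematicalPhysics.QuantumLattice.hubbardTorus 2 (L + 1) 1 U) N 0 ψ → (Literature.MathematicalPhysics.QuantumLattice.expect ((Literature.MathematicalPhysics.QuantumLattice.pairField Literature.MathematicalPhysics.QuantumLattice.dWaveFormFactor (L + 1))ᴴ * Literature.MathematicalPhysics.QuantumLattice.pairField Literature.MathematicalPhysics.QuantumLattice.dWaveFormFactor (L + 1)) ψ).re ≤ (A * (1 - (N : ℝ) / ((L : ℝ) + 1) ^ 2) + B / Real.sqrt U) * ((L : ℝ) + 1) ^ 4 + A * ((L : ℝ) + 1) ^ 3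

/-- item stmt-HubbardSuperconductivity-1462 · crux · rank 3 · closed · moot by None · by planner
why it might fail: Chebyshev window jU-2mu_L-eps >= jU/2 needs |E(N_L+2)-E(N_L)|, kappa_L <= C(delta) for all large L (stmt-1463, unproved; E_L(N) non-convex under phase separation, EmeryKivelsonLin1990); a hidden L-loss in ||[T,X_j^+]||<=c_T L^2, the Markov tail or ||G^+psi||^2<=c_G L^2 HH leaves only L^3√HH.
sources: KomaTasaki1994, HorschVonDerLinden1988, DattaFernandezFrohlich1999, EmeryKivelsonLin1990, Tasaki2020
[crux] SHARP MOTT-CORNER LAW (the card's mechanism; wedge U >= U1(delta)): eventually in L, every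
normalised (N_L, S^z=0)-sector GS psi has re<Delta_d^+ Delta_d> <= A L^2 HH(psi) + (B/U^2 + eta) L^4
-- order <= A (hole-PAIR density) + B t^2/U^2, no Schrieffer-Wolff. Sketch (K = H - mu N, 2mu =
E(N+2) - E(N), Phi = Delta^+ psi): <Delta^+ Delta> = ||Phi||^2 - <[Delta,Delta^+]> with
||[Delta,Delta^+]|| <= c0 L^2. TAIL: ||1_{>eps}(K - E^K) Phi||^2 <= a/eps, a + r =
<[Delta,[K,Delta^+]]> <= C_D(U) L^2, -r <= kappa_L ||Delta psi||^2 (KomaTasaki1994 Thm 2.2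
forwards). LOW PART: Delta^+ = G^+ + X_1^+ + X_2^+ (exact doublon grading, [D, X_j^+] = j X_j^+), (K
- E^K - (jU - 2mu)) X_j^+ psi = [T, X_j^+] psi of norm <= c_T L^2, so Chebyshev (spectral measure)
gives ||1_{<=eps} X_j^+ psi|| <= c_T L^2/(jU - 2mu - eps) <= 2c_T L^2/(jU) once U >= 2(2mu + eps);
||G^+ psi||^2 <= c_G L^2 HH (G_x^+ = G_x^+ Q_x, Cauchy-Schwarz). With eps := 2kappa_L + 1 (kappa_L,
|2mu| <= C(delta), SectorPairEnergyBounds): ||Delta psi||^2 / 2 <= 2 c_G L^2 HH + 18 c_T^2 L^4/U^2 +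
(C_D(U)/eps + c0) L^2 (last term < eta L^4 eventually). A = 4c_G, B = 36c_T^2, U1(delta) =
2(3C(delta)+1); for the true SU(2) GS, no expansion. -/
@[route_item "route-HubbardSuperconductivity-MottCornerCeiling"]
def MottCornerLawSharp : Prop :=
  ∃ A B : ℝ, ∀ δ ∈ Set.Ioo (0 : ℝ) 1, ∃ U₁ : ℝ, ∀ (U : ℝ), U₁ ≤ U → ∀ η : ℝ, 0 < η → ∀ᶠ L : ℕ in Filter.atTop, ∀ (ψ : Literature.MathematicalPhysics.QuantumLattice.Fock (Literature.MathematicalPhysics.QuantumLattice.Orb (Literature.MathematicalPhysics.QuantumLattice.FermionTorus 2 (L + 1)))), star ψ ⬝ᵥ ψ = 1 → Literature.MathematicalPhysics.QuantumLattice.IsGroundStateInSector (Literature.MathematicalPhysics.QuantumLattice.hubbardTorus 2 (L + 1) 1 U) (2 * ⌊(1 - δ) * ((L + 1) : ℝ) ^ 2 / 2⌋₊) 0 ψ → (Literature.MathematicalPhysics.QuantumLattice.expect ((Literature.MathematicalPhysics.QuantumLattice.pairField Literature.MathematicalPhysics.QuantumLattice.dWaveFormFactor (L + 1))ᴴ *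 Literature.MathematicalPhysics.QuantumLattice.pairField Literature.MathematicalPhysics.QuantumLattice.dWaveFormFactor (L + 1)) ψ).re ≤ A * ((L : ℝ) + 1) ^ 2 * (∑ x : Literature.Probability.LatticeModels.TorusSite 2 (L + 1), ∑ e ∈ Literature.MathematicalPhysics.QuantumLattice.unitSteps, (Literature.MathematicalPhysics.QuantumLattice.expect ((1 - Literature.MathematicalPhysics.QuantumLattice.numberOp (Literature.MathematicalPhysics.QuantumLattice.FermionTorus.ofTorusSite x) 0) * (1 - Literature.MathematicalPhysics.QuantumLattice.numberOp (Literature.MathematicalPhysics.QuantumLattice.FermionTorus.ofTorusSite x) 1) * ((1 - Literature.MathematicalPhysics.QuantumLattice.numberOp (Literature.MathematicalPhysics.QuantumLattice.FermionTorus.ofTorusSite (x + Literature.Probability.LatticeModels.Torus.proj (L + 1) e)) 0) * (1 - Literature.MathematicalPhysics.QuantumLattice.numberOp (Literature.MathematicalPhysics.QuantumLattice.FermionTorus.ofTorusSite (x + Literature.Probability.LatticeModels.Torus.proj (L + 1) e)) 1))) ψ).re) + (B / U ^ 2 + η) * ((L : ℝ) + 1) ^ 4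

/-- item stmt-HubbardSuperconductivity-1461 · support · rank 2 · closed · moot by None · by planner
why it might fail: The LINEAR hole term needs two-sided conditioning over all 16 spectator-spin channels on disjoint bonds; one common/common channel mis-booked => only the (A)-form sqrt(L^2 HH) survives and the delta-linear law dies. Near pairs and the e=0 on-site term (general g) must fit C L^2 + C L^3 sqrt D.
sources: Toth1991, TennieVedralSchilling2017, Yang1962, Tasaki1998
[crux] HOLE-PAIR ROOM (every state, every form factor g; the engine; from the retired card
hole-pair-room-mottness-ceiling, linear form). For every normalised psi on the L-torus: re<psi,
Delta_g^+ Delta_g psi> <= C_g (L^2 HH(psi) + L^3 sqrt(D(psi)) + L^2), HH = Sum_x Sum_{e in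
unitSteps} <E_x E_{x+e}> with E_x = (1-n_{x up})(1-n_{x dn}), D = Sum_x <n_{x up} n_{x dn}>. Sketch:
Delta_g = Sum_x P_x, P_x = Sum_tau a_tau A_tau(x), A_tau = c_{i s} c_{j s'} on a bond. For disjoint
bonds insert A_tau(y) psi = Sum_{ab} A_tau(y) Pi_y^{ab} psi (tau-orbitals occupied, spectator spins
ab) on BOTH sides; A_tau(y) Pi_y^{ab} psi lies in range Q_y^{ab} (tau-orbitals empty, spectators ab)
and the Q's commute across bonds, so each of the 16 channel terms is <= ||A||^2 sqrt P(Y_empty^ab &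
X_occ^a'b') sqrt P(X_empty^a'b' & Y_occ^ab). Channel (00,00): both factors <= sqrt(bond empty) =>
(Sum_b sqrt p_b)^2 <= 4 L^2 HH: the LINEAR hole term. Every other channel has a doublon on one side
=> <= C L^3 sqrt D. On-site (e=0) pairs need a doublon: same class. Overlapping bonds: O(L^2) pairs
=> C L^2. Lean: diagonal occupation projectors (HubbardLiebBasis.lean:178), Cauchy-Schwarz on Finset
sums. -/
@[route_item "route-HubbardSuperconductivity-MottCornerCeiling"]
def HolePairRoom : Prop :=
  ∀ g : Literature.Probability.LatticeModels.Site 2 → ℝ, ∃ C : ℝ, ∀ (L : ℕ) [NeZero L] (ψ : Literature.MathematicalPhysics.QuantumLattice.Fock (Literature.MathematicalPhysics.QuantumLattice.Orb (Literature.MathematicalPhysics.QuantumLattice.FermionTorus 2 L))), star ψ ⬝ᵥ ψ = 1 → (Literature.MathematicalPhysics.QuantumLattice.expect ((Literature.MathematicalPhysics.QuantumLattice.pairField g L)ᴴ * Literature.MathematicalPhysics.QuantumLattice.pairField g L) ψ).re ≤ C * ((L : ℝ) ^ 2 * (∑ x : Literature.Probability.LatticeModels.TorusSite 2 L, ∑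 e ∈ Literature.MathematicalPhysics.QuantumLattice.unitSteps, (Literature.MathematicalPhysics.QuantumLattice.expect ((1 - Literature.MathematicalPhysics.QuantumLattice.numberOp (Literature.MathematicalPhysics.QuantumLattice.FermionTorus.ofTorusSite x) 0) * (1 - Literature.MathematicalPhysics.QuantumLattice.numberOp (Literature.MathematicalPhysics.QuantumLattice.FermionTorus.ofTorusSite x) 1) * ((1 - Literature.MathematicalPhysics.QuantumLattice.numberOp (Literature.MathematicalPhysics.QuantumLattice.FermionTorus.ofTorusSite (x + Literature.Probability.LatticeModels.Torus.proj L e)) 0) * (1 - Literature.MathematicalPhysics.QuantumLattice.numberOp (Literature.MathematicalPhysics.QuantumLattice.FermionTorus.ofTorusSite (x + Literature.Probability.LatticeModels.Torus.proj L e)) 1))) ψ).re) + (L : ℝ) ^ 3 * Real.sqrt (∑ y : Literature.MathematicalPhysics.QuantumLattice.FermionTorus 2 L, (Literature.MathematicalPhysics.QuantumLattice.expect (Literature.MathematicalPhysics.QuantumLattice.numberOp y 0 * Literature.MathematicalPhysics.QuantumLattice.numberOp y 1) ψ).re) + (L : ℝ) ^ 2)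

/-- item stmt-HubbardSuperconductivity-1463 · support · rank 4 · closed · moot by None · by planner
why it might fail: Variational sketches only: needs sector minimisers to be eigenvectors, max P(x,y empty) >= delta^2/2 and P(x up,y dn occ) >= (1-delta)^2/8 eventually, [D,c^+(1-n)]=0 with fermion signs; phase separation at small delta (Emery-Kivelson-Lin): E_L(N) not convex, so kappa_L <= C is the most one can hope.
sources: Lieb1989, Tasaki2020, EmeryKivelsonLin1990, Tasaki1998
[crux] SECTOR PAIR-ENERGY BOUNDS (replaces the card's hypothesis H1; feeds MottCornerLawSharp): for
each delta in (0,1) a constant C(delta), uniform in U > 0 and in large L, with E(M) := minEnergyOn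
(hubbardTorus 2 L 1 U) (szSector M 0), N_L = 2*floor((1-delta)L^2/2): |E(N_L+2) - E(N_L)| <= C and
kappa_L := 2E(N_L) - E(N_L-2) - E(N_L+2) <= C (C = O(t/delta + t/(1-delta))). Sketch: (i) E(N+2) -
E(N) <= 64 sqrt2/delta: insert two electrons into the N-sector minimiser psi with a^+ = c^+_{x
up}(1-n_{x dn}) c^+_{y dn}(1-n_{y up}), x != y chosen so that ||a^+ psi||^2 = P(x, y both empty) >=
delta^2/2 (pair average >= delta_L^2 - 1/L^2 by Cauchy-Schwarz); [D, a^+] = 0 (no doublon created),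
hence E(N+2) - E(N) <= ||[T, a^+]||/||a^+ psi||. (ii) E(N) - E(N+2) <= C'/(1-delta): remove c_{x up}
c_{y dn} from the (N+2)-minimiser; the U-part of <(cc)^+[H, cc]> is -U<n n n> <= 0, and max_{x != y}
P(x up & y dn occupied) >= ((N/2)^2 - D)/L^4 >= (1-delta)^2/8. (iii) kappa_L = [E(N) - E(N-2)] +
[E(N) - E(N+2)] by (i) at N-2 and (ii). Minimisers exist and are H-eigenvectors (H Hermitian,
sector-preserving; sectors nonempty eventually). Physically mu^+ = O(t); O(t/delta) suffices here. -/
@[route_item "route-HubbardSuperconductivity-MottCornerCeiling"]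
def SectorPairEnergyBounds : Prop :=
  ∀ δ ∈ Set.Ioo (0 : ℝ) 1, ∃ C : ℝ, ∀ (U : ℝ), 0 < U → ∀ᶠ L : ℕ in Filter.atTop, |(Literature.MathematicalPhysics.QuantumLattice.hubbardTorus 2 L 1 U).minEnergyOn (Literature.MathematicalPhysics.QuantumLattice.szSector (2 * ⌊(1 - δ) * (L : ℝ) ^ 2 / 2⌋₊ + 2) 0) - (Literature.MathematicalPhysics.QuantumLattice.hubbardTorus 2 L 1 U).minEnergyOn (Literature.MathematicalPhysics.QuantumLattice.szSector (2 * ⌊(1 - δ) * (L : ℝ) ^ 2 / 2⌋₊) 0)| ≤ C ∧ 2 * (Literature.MathematicalPhysics.QuantumLattice.hubbardTorus 2 L 1 U).minEnergyOn (Literature.MathematicalPhysics.QuantumLattice.szSector (2 * ⌊(1 - δ) * (L : ℝ) ^ 2 / 2⌋₊) 0) - (Literature.MathematicalPhysics.QuantumLattice.hubbardTorus 2 L 1 U).minEnergyOn (Literature.MathematicalPhysics.QuantumLattice.szSector (2 * ⌊(1 - δ) * (L : ℝ) ^ 2 / 2⌋₊ - 2) 0) - (Literature.MathematicalPhysics.QuantumLattice.hubbardTorus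 2 L 1 U).minEnergyOn (Literature.MathematicalPhysics.QuantumLattice.szSector (2 * ⌊(1 - δ) * (L : ℝ) ^ 2 / 2⌋₊ + 2) 0) ≤ C

/-- item stmt-HubbardSuperconductivity-1464 · support · rank 9 · closed · moot by None · by planner
sources: Lieb1989, Yang1962
[support] GROUND-STATE DOUBLON BUDGET: for U > 0, N <= L^2 and every normalised (N, S^z=0)-sector
ground state psi of hubbardTorus 2 L 1 U: U * Sum_x <n_{x up} n_{x dn}> <= 4N (t = 1), i.e. doublon
density <= 4 n t/U. Proof: E := minEnergyOn <= 0 by the trial basis state with N/2 up and N/2 down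
electrons on N distinct sites (its diagonal matrix element of H is 0; N odd => szSector N 0 = bot =>
hypothesis impossible); E = <T>_psi + U D(psi); <T>_psi = tr(h rho_1) >= -||h|| tr rho_1 >= -4N
since rho_1 = oneParticleRDM psi is PSD with trace N (named fact oneParticleRDM_posSemidef_trace)
and the torus adjacency matrix has norm <= max degree <= 4 (degree 2 at L = 2, 0 at L = 1). Routine
calibration item; anyone idle may take it. -/
@[route_item "route-HubbardSuperconductivity-MottCornerCeiling"]
def GroundStateDoublonBudget : Prop :=
  ∀ (L : ℕ) [NeZero L] (U : ℝ), 0 < U → ∀ (N : ℕ) (ψ : Literature.MathematicalPhysics.QuantumLattice.Fock (Literature.MathematicalPhysics.QuantumLattice.Orb (Literature.MathematicalPhysics.QuantumLattice.FermionTorus 2 L))), N ≤ L ^ 2 → star ψ ⬝ᵥ ψ = 1 → Literature.MathematicalPhysics.QuantumLattice.IsGroundStateInSector (Literature.MathematicalPhysics.QuantumLattice.hubbardTorus 2 L 1 U) N 0 ψ → U * (∑ y : Literature.MathematicalPhysics.QuantumLattice.FermionTorus 2 L, (Literature.MathematicalPhysics.QuantumLattice.expect (Literature.MathematicalPhysics.QuantumLattice.numberOp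 y 0 * Literature.MathematicalPhysics.QuantumLattice.numberOp y 1) ψ).re) ≤ 4 * (N : ℝ)

/-- item stmt-HubbardSuperconductivity-8975 · support · rank 9 · open · by planner
[support] HOLE-PAIR ROOM, ℓ^{1/2} FORM (every state, every form factor g; provable now; strengthens
HolePairRoom, which it implies by S² ≤ 4L²·HH and L²D ≤ L³√D). For every normalised ψ on the
L-torus: re⟨Δ_g†Δ_g⟩ ≤ C_g(S(ψ)² + L²·D(ψ) + L²), S := Σ_x Σ_{e∈unitSteps} √⟨E_x E_{x+e}⟩, D :=
Σ_x⟨n_{x↑}n_{x↓}⟩. PROOF SKETCH (no 16-channel bookkeeping): localPair = Σ_e (g_e/√2)(c_{x↑}c_{y↓} −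
c_{x↓}c_{y↑}), y = x+e; index b = (x, e, orientation). Split each bond term by the commuting
projectors in n_{x,σ̄}, n_{y,σ̄'}: Δ_g = G + X₁ + X₂ with G_b = c_{x↑}c_{y↓}(1−n_{x↓})(1−n_{y↑}) (no
doublon touched: both ends become EMPTY), X_{j,b} the parts removing exactly j doublons (on-site e =
0 terms are X₁-type). (i) ‖Δψ‖² ≤ 3(‖Gψ‖² + ‖X₁ψ‖² + ‖X₂ψ‖²). (ii) G_b† = G_b†E_b with E_b := E_xE_y
(creation needs both ends empty, the projector then holds automatically); for DISJOINT b, b': E_b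
commutes with G_{b'} and G_b† (even) commutes with G_{b'}, so ⟨G_bψ, G_{b'}ψ⟩ = ⟨ψ, G_{b'}G_b†E_bψ⟩
= ⟨G_{b'}†E_{b'}ψ, G_b†E_bψ⟩, |·| ≤ ‖E_bψ‖‖E_{b'}ψ‖ = √(p_b p_{b'}) (‖G†‖ ≤ 1); overlapping pairs:
at most 32 per b, each ≤ ‖G_bψ‖‖G_{b'}ψ‖ ≤ 1 ⇒ O(L²). Hence ‖Gψ‖² ≤ (‖g‖∞²/2)((Σ_b√p_b)² + 32·8L²)
and (Σ_b√p_b)² = 4 -/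
@[route_item "route-HubbardSuperconductivity-MottCornerCeiling"]
def HolePairRoomSqrt : Prop :=
  ∀ g : Literature.Probability.LatticeModels.Site 2 → ℝ, ∃ C : ℝ, ∀ (L : ℕ) [NeZero L] (ψ : Literature.MathematicalPhysics.QuantumLattice.Fock (Literature.MathematicalPhysics.QuantumLattice.Orb (Literature.MathematicalPhysics.QuantumLattice.FermionTorus 2 L))), star ψ ⬝ᵥ ψ = 1 → (Literature.MathematicalPhysics.QuantumLattice.expect ((Literature.MathematicalPhysics.QuantumLattice.pairField g L)ᴴ * Literature.MathematicalPhysics.QuantumLattice.pairField g L) ψ).re ≤ C * ((∑ x : Literature.Probability.LatticeModels.TorusSite 2 L, ∑ e ∈ Literature.MathematicalPhysics.QuantumLattice.unitSteps, Real.sqrt ((Literature.MathematicalPhysics.QuantumLattice.expect ((1 - Literature.MathematicalPhysics.QuantumLattice.numberOp (Literature.MathematicalPhysics.QuantumLattice.FermionTorus.ofTorusSite x) 0) * (1 - Literature.MathematicalPhysics.QuantumLattice.numberOp (Literature.MathematicalPhysics.QuantumLattice.FermionTorus.ofTorusSite x) 1) * ((1 - Literature.MathematicalPhysics.QuantumLattice.numberOp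 (Literature.MathematicalPhysics.QuantumLattice.FermionTorus.ofTorusSite (x + Literature.Probability.LatticeModels.Torus.proj L e)) 0) * (1 - Literature.MathematicalPhysics.QuantumLattice.numberOp (Literature.MathematicalPhysics.QuantumLattice.FermionTorus.ofTorusSite (x + Literature.Probability.LatticeModels.Torus.proj L e)) 1))) ψ).re)) ^ 2 + (L : ℝ) ^ 2 * (∑ y : Literature.MathematicalPhysics.QuantumLattice.FermionTorus 2 L, (Literature.MathematicalPhysics.QuantumLattice.expect (Literature.MathematicalPhysics.QuantumLattice.numberOp y 0 * Literature.MathematicalPhysics.QuantumLattice.numberOp y 1) ψ).re) + (L : ℝ) ^ 2)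

/-- item stmt-HubbardSuperconductivity-1466 · assembly · rank 1 · closed · moot by None · by planner
sources: Scalapino1995
[assembly] CEILING ROUTE: the assembly concludes the route target MottCornerLaw, deliberately NOT
the constant HubbardSuperconductivity (an O(delta) > 0 ceiling is load-bearing for neither S nor
not-S at any fixed (U, delta); see the thesis). Glue = bookkeeping: HH(psi) <= 4<#empty sites> =
4(L^2 - N + D(psi)) on the N-particle sector, D(psi) <= 4N/U from the budget, then arithmetic with U
>= 1 (16/U <= 16/sqrt U) and C L^2 <= A L^3 at side L + 1. -/
@[route_item "route-HubbardSuperconductivity-MottCornerCeiling"]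
def Assembly : Prop :=
  HolePairRoom → GroundStateDoublonBudget → MottCornerLaw

end Summit.HubbardSuperconductivity.HubbardSuperconductivity.Theses.MottCornerCeiling
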